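import Literature.AlgebraicGeometry.Limits.FiniteLocallyFreeDescentStages
import Literature.AlgebraicGeometry.Modules.IsoOfFrames
import Literature.AlgebraicGeometry.Modules.PullbackFrame
import Literature.AlgebraicGeometry.Modules.MatrixCocycleFrame
import Literature.AlgebraicGeometry.Modules.AdaptedFrame
import HarnessLib

/-!
# Limits of schemes: a finite locally free module on the limit comes from a stage
# (The Stacks Project, Lemma 32.10.3 (1), Tag 0B8W)

Topic: `Literature/AlgebraicGeometry/Limits`. For the limit `c.pt = lim_i D i` of a cofiltered
diagram of quasi-compact quasi-separated schemes with affine transition maps and a finite locally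
free `𝒪_{c.pt}`-module `E` (`Motives.IsFiniteLocallyFree`: locally `≅ 𝒪^J`, `J` finite):

* `exists_isFiniteLocallyFree_pullback_iso` — **there are a stage `i` and a finite locally free
  `𝒪_{D i}`-module `ℰ` with `π_i^* ℰ ≅ E`** (Stacks 0B8W (1); Görtz–Wedhorn I, Thm. 10.60 /
  Exercise 10.33 for vector bundles; EGA IV₃ 8.5.2, 8.5.5).

Proof, by transition matrices (no finitely presented modules needed): `Limits/
FiniteLocallyFreeDescentStages` trivialises `E` on preimages `π_i⁻¹ V_a` of quasi-compact opens of
one stage and descends the transition matrices together with the identities `T_{aa} = 1`,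
`T_{ab} T_{bd} = T_{ad}` and the covering to a stage `D k`; there the matrices form a
`Modules.MatrixCocycle`, whose glued module (`Modules/MatrixCocycleGluing`) is finite locally free
with frames whose transition matrices are the `T_{ab}` (`Modules/MatrixCocycleFrame`); the
pulled-back frames of `π_k^*` of the glued module (`Modules/PullbackFrame`,
`transition_pullbackFrame`) and the (restricted) frames of `E` then have the same transition
matrices, so the two modules are isomorphic (`Modules/IsoOfFrames`). This is the surjectivity
half of "vector bundles on `lim D i` = colim of vector bundles on the `D i`"; it is the tool by
which a vector bundle on a variety over a field `K = colim A` (f.g. subalgebras `A`) acquires a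
model over some `A` (EGA IV₃ 8.9.1). Everything is proved; no named facts.

## Edition 2 (2026-08-29)

Docstring-only re-filing (watcher-trigger edition, cell `hodgecm-mathlib`, director ruling s149):
the declarations below are byte-identical to edition 1 (2026-08-21); the file is re-submitted so
that the hub build lane produces this module's `.olean`, which the downstream importers
`Limits/FiniteLocallyFreeSubalgebraDescent` (this topic) and `KTheory/KZeroLimitDescent`, and the
2026-08-29 consumer `AbelianSchemes/RigidifiedLineBundleLimitDescentStage` (M13 node N0 (0d), G4),
need.

## References

* The Stacks Project, Lemma 32.10.3 (Tag 0B8W) (1). [StacksProject]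
* U. Görtz, T. Wedhorn, *Algebraic Geometry I*, 2nd ed. (2020), Thm. 10.60, Exercise 10.33.
  [GortzWedhorn2020]
* A. Grothendieck, J. Dieudonné, EGA IV₃ (1966), Thm. 8.5.2, Cor. 8.5.5, 8.9.1.
* R. Hartshorne, *Algebraic Geometry* (1977), II Ex. 5.18. [Hartshorne1977]
-/

universe u

open CategoryTheory CategoryTheory.Limits AlgebraicGeometry TopologicalSpace Opposite
open Literature.AlgebraicGeometry.Motives Literature.AlgebraicGeometry.Modules

namespace Literature.AlgebraicGeometry.Limits

set_option backward.isDefEq.respectTransparency false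

variable {I : Type u} [Category.{u} I] [IsCofiltered I] (D : I ⥤ Scheme.{u})
  (c : Cone D) (hc : IsLimit c) [∀ {i j : I} (f : i ⟶ j), IsAffineHom (D.map f)]
  [∀ i, CompactSpace (D.obj i)] [∀ i, QuasiSeparatedSpace (D.obj i)]

namespace FiniteLocallyFreeDescent

/-! ### Plumbing: matrices of sections under `appLE` and restriction -/

omit [IsCofiltered I] [∀ {i j : I} (f : i ⟶ j), IsAffineHom (D.map f)]
  [∀ i, CompactSpace (D.obj i)] [∀ i, QuasiSeparatedSpace (D.obj i)] in
/-- Changing the name of the morphism in `Scheme.Hom.appLE`. [folklore] -/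
private lemma appLE_congr_hom' {X Y : Scheme.{u}} {f g : X ⟶ Y} (h : f = g) (U : Y.Opens)
    (V : X.Opens) (e : V ≤ f ⁻¹ᵁ U) : f.appLE U V e = g.appLE U V (h ▸ e) := by
  subst h; rfl

omit [IsCofiltered I] [∀ {i j : I} (f : i ⟶ j), IsAffineHom (D.map f)]
  [∀ i, CompactSpace (D.obj i)] [∀ i, QuasiSeparatedSpace (D.obj i)] in
/-- `appLE` after restricting a matrix is one `appLE`. [folklore] -/
private lemma map_secRes_map_appLE' {X Y : Scheme.{u}} (f : X ⟶ Y) {W W' : Y.Opens} {O : X.Opens}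
    (h : W' ≤ W) (e' : O ≤ f ⁻¹ᵁ W') {m n : Type*} (M : Matrix m n Γ(Y, W)) :
    (M.map (secRes Y h)).map (f.appLE W' O e').hom =
      M.map (f.appLE W O (e'.trans ((Opens.map f.base).map (homOfLE h)).le)).hom := by
  rw [Matrix.map_map]
  congr 1
  funext s
  change (Y.presheaf.map (homOfLE h).op ≫ f.appLE W' O e') s = _
  rw [Scheme.Hom.map_appLE]

omit [IsCofiltered I] [∀ {i j : I} (f : i ⟶ j), IsAffineHom (D.map f)]
  [∀ i, CompactSpace (D.obj i)] [∀ i, QuasiSeparatedSpace (D.obj i)] in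
/-- Restricting a matrix after `appLE` is one `appLE`. [folklore] -/
private lemma map_appLE_map_secRes' {X Y : Scheme.{u}} (f : X ⟶ Y) {W : Y.Opens} {O O' : X.Opens}
    (h' : O' ≤ O) (e : O ≤ f ⁻¹ᵁ W) {m n : Type*} (M : Matrix m n Γ(Y, W)) :
    (M.map (f.appLE W O e).hom).map (secRes X h') = M.map (f.appLE W O' (h'.trans e)).hom := by
  rw [Matrix.map_map]
  congr 1
  funext s
  change (f.appLE W O e ≫ X.presheaf.map (homOfLE h').op) s = _
  rw [Scheme.Hom.appLE_map]

omit [IsCofiltered I] [∀ {i j : I} (f : i ⟶ j), IsAffineHom (D.map f)]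
  [∀ i, CompactSpace (D.obj i)] [∀ i, QuasiSeparatedSpace (D.obj i)] in
/-- Two successive `appLE`s of a matrix are one `appLE` of the composite. [folklore] -/
private lemma map_appLE_map_appLE' {X Y Z : Scheme.{u}} (f : X ⟶ Y) (g : Y ⟶ Z) {U : Z.Opens}
    {V : Y.Opens} {W : X.Opens} (e₁ : V ≤ g ⁻¹ᵁ U) (e₂ : W ≤ f ⁻¹ᵁ V) {m n : Type*}
    (M : Matrix m n Γ(Z, U)) :
    (M.map (g.appLE U V e₁).hom).map (f.appLE V W e₂).hom =
      M.map ((f ≫ g).appLE U W (e₂.trans ((Opens.map f.base).map (homOfLE e₁)).le)).hom := by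
  rw [Matrix.map_map]
  congr 1
  funext s
  change (g.appLE U V e₁ ≫ f.appLE V W e₂) s = _
  rw [Scheme.Hom.appLE_comp_appLE]

end FiniteLocallyFreeDescent

/-! ### Step 4: the glued bundle on a stage and the comparison with `E` -/

open FiniteLocallyFreeDescent in
include hc in
/-- **Finite locally free modules on a limit come from a stage** (The Stacks Project, Lemma
32.10.3 (1), Tag 0B8W): if `c.pt = lim_i D i` is the limit of a cofiltered diagram of
quasi-compact quasi-separated schemes with affine transition maps, every finite locally free
`𝒪_{c.pt}`-module `E` is isomorphic to `π_i^* ℰ` for some `i` and some finite locally free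
`𝒪_{D i}`-module `ℰ`. Proof (Görtz–Wedhorn I, Thm. 10.60 pattern, through transition matrices
rather than finitely presented modules): trivialise `E` on preimages of quasi-compact opens of one
stage (`exists_frames`), descend the transition matrices (`exists_stage_transition`), then the
cocycle identities and the covering (`exists_stage_cocycle`) to a deeper stage, glue the free
modules there along the descended cocycle (`Modules/MatrixCocycleGluing`,
`Modules/MatrixCocycleFrame`), and compare `π^*` of the glued module with `E` through their frames,
which have the same transition matrices (`Modules/PullbackFrame`, `Modules/IsoOfFrames`).
[cite: StacksProject, Tag 0B8W (Lemma 32.10.3 (1))] -/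
theorem exists_isFiniteLocallyFree_pullback_iso {E : c.pt.Modules} (hE : IsFiniteLocallyFree E) :
    ∃ (i : I) (ℰ : (D.obj i).Modules), IsFiniteLocallyFree ℰ ∧
      Nonempty ((Scheme.Modules.pullback (c.π.app i)).obj ℰ ≅ E) := by
  classical
  -- Steps 1–3
  obtain ⟨i₀, ι, _, V, J, _, U, e, hUV, hVc, hUtop⟩ := exists_frames D c hc hE
  obtain ⟨j, f, T, hle, hT⟩ := exists_stage_transition D c hc e V hVc hUV
  obtain ⟨k, g, hW, hself, hcoc, hcov⟩ :=
    exists_stage_cocycle D c hc e V hVc hUV hUtop f T hle hT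
  -- the matrices `G a b` on the final stage `D k`, over `W a ⊓ W b`, `W a := (D g)⁻¹ (D f)⁻¹ V a`
  obtain ⟨G, hGdef⟩ : ∃ G : ∀ a b, Matrix (J a) (J b)
      Γ(D.obj k, D.map g ⁻¹ᵁ (D.map f ⁻¹ᵁ V a) ⊓ D.map g ⁻¹ᵁ (D.map f ⁻¹ᵁ V b)),
      ∀ a b, G a b = (T a b).map ((D.map g).appLE _ _ (hW a b)).hom := ⟨_, fun a b => rfl⟩
  have hGself : ∀ a, G a a = 1 := fun a => by rw [hGdef]; exact hself a
  have hGcoc : ∀ a b d,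
      (G a b).map (secRes (D.obj k) (inf_le_left :
          D.map g ⁻¹ᵁ (D.map f ⁻¹ᵁ V a) ⊓ D.map g ⁻¹ᵁ (D.map f ⁻¹ᵁ V b) ⊓
            D.map g ⁻¹ᵁ (D.map f ⁻¹ᵁ V d) ≤ _)) *
        (G b d).map (secRes (D.obj k) (le_inf (inf_le_left.trans inf_le_right) inf_le_right :
          D.map g ⁻¹ᵁ (D.map f ⁻¹ᵁ V a) ⊓ D.map g ⁻¹ᵁ (D.map f ⁻¹ᵁ V b) ⊓
            D.map g ⁻¹ᵁ (D.map f ⁻¹ᵁ V d) ≤ _)) =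
      (G a d).map (secRes (D.obj k) (le_inf (inf_le_left.trans inf_le_left) inf_le_right :
          D.map g ⁻¹ᵁ (D.map f ⁻¹ᵁ V a) ⊓ D.map g ⁻¹ᵁ (D.map f ⁻¹ᵁ V b) ⊓
            D.map g ⁻¹ᵁ (D.map f ⁻¹ᵁ V d) ≤ _)) :=
    fun a b d => by rw [hGdef, hGdef, hGdef]; exact hcoc a b d
  -- the cocycle of matrices on `D k` and the glued finite locally free module
  let C : MatrixCocycle (D.obj k) ι :=
    { U := fun a => D.map g ⁻¹ᵁ (D.map f ⁻¹ᵁ V a)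
      I := J
      g := fun a b O ha hb => (G a b).map (secRes (D.obj k) (le_inf ha hb))
      map_g := fun a b O O' ha hb hi => by
        rw [Matrix.map_map]
        congr 1
        funext s
        exact secRes_secRes _ _ s
      g_mul := fun a b d O ha hb hd => by
        have h3 : O ≤ D.map g ⁻¹ᵁ (D.map f ⁻¹ᵁ V a) ⊓ D.map g ⁻¹ᵁ (D.map f ⁻¹ᵁ V b) ⊓
            D.map g ⁻¹ᵁ (D.map f ⁻¹ᵁ V d) := le_inf (le_inf ha hb) hd
        have r : ∀ (a' b' : ι)
            (h₁ : D.map g ⁻¹ᵁ (D.map f ⁻¹ᵁ V a) ⊓ D.map g ⁻¹ᵁ (D.map f ⁻¹ᵁ V b) ⊓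
              D.map g ⁻¹ᵁ (D.map f ⁻¹ᵁ V d) ≤
              D.map g ⁻¹ᵁ (D.map f ⁻¹ᵁ V a') ⊓ D.map g ⁻¹ᵁ (D.map f ⁻¹ᵁ V b'))
            (h₂ : O ≤ D.map g ⁻¹ᵁ (D.map f ⁻¹ᵁ V a') ⊓ D.map g ⁻¹ᵁ (D.map f ⁻¹ᵁ V b')),
            (G a' b').map (secRes (D.obj k) h₂) =
              ((G a' b').map (secRes (D.obj k) h₁)).map (secRes (D.obj k) h3) := by
          intro a' b' h₁ h₂
          rw [Matrix.map_map]
          congr 1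
          funext s
          exact (secRes_secRes h₁ h3 s).symm
        rw [r a b inf_le_left, r b d (le_inf (inf_le_left.trans inf_le_right) inf_le_right),
          r a d (le_inf (inf_le_left.trans inf_le_left) inf_le_right), ← Matrix.map_mul,
          hGcoc]
      g_self := fun a O ha => by
        rw [hGself, Matrix.map_one _ (map_zero _) (map_one _)] }
  have hℰ : IsFiniteLocallyFree C.glued := C.isFiniteLocallyFree_glued fun x => by
    have hx : x ∈ (⨆ a, D.map g ⁻¹ᵁ (D.map f ⁻¹ᵁ V a)) := by rw [hcov]; trivial
    exact Opens.mem_iSup.mp hx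
  -- the comparison over the limit: `π_k^* (glued)` and `E` have frames on the opens
  -- `π_k⁻¹ W a = U a` with the same transition matrices
  have hw : ∀ {j' k' : I} (m : k' ⟶ j'), (c.π.app k' ≫ D.map m : c.pt ⟶ D.obj j') = c.π.app j' :=
    fun m => c.w m
  have hWU : ∀ a, (c.π.app k ⁻¹ᵁ (D.map g ⁻¹ᵁ (D.map f ⁻¹ᵁ V a)) : c.pt.Opens) = U a := fun a => by
    rw [← hUV a, ← Scheme.Hom.comp_preimage, ← Scheme.Hom.comp_preimage, c.w, c.w]
  let eM : ∀ a, SheafOfModules.free (J a) ≅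
      ((Scheme.Modules.pullback (c.π.app k)).obj C.glued).over
        (c.π.app k ⁻¹ᵁ (D.map g ⁻¹ᵁ (D.map f ⁻¹ᵁ V a))) := fun a =>
    pullbackFrame (c.π.app k) (C.frame a)
  let eN : ∀ a, SheafOfModules.free (J a) ≅
      E.over (c.π.app k ⁻¹ᵁ (D.map g ⁻¹ᵁ (D.map f ⁻¹ᵁ V a))) := fun a =>
    SheafOfModules.restrictTrivialisation (R := c.pt.ringCatSheaf) (eqToHom (hWU a)) (e a)
  -- both transition matrices equal `π_j^♯ T_{ab}` restricted to `π_k⁻¹ W a ⊓ π_k⁻¹ W b`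
  have hle₂ : ∀ a b, (c.π.app k ⁻¹ᵁ (D.map g ⁻¹ᵁ (D.map f ⁻¹ᵁ V a)) ⊓
      c.π.app k ⁻¹ᵁ (D.map g ⁻¹ᵁ (D.map f ⁻¹ᵁ V b)) : c.pt.Opens) ≤ U a ⊓ U b := fun a b =>
    inf_le_inf (hWU a).le (hWU b).le
  have hTM : ∀ a b, transition (eM a) (eM b) (Opens.infLELeft _ _) (Opens.infLERight _ _) =
      (T a b).map ((c.π.app j).appLE (D.map f ⁻¹ᵁ V a ⊓ D.map f ⁻¹ᵁ V b) _
        ((hle₂ a b).trans (hle a b))).hom := by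
    intro a b
    simp only [eM]
    rw [transition_pullbackFrame (c.π.app k) (C.frame a) (C.frame b) le_rfl,
      MatrixCocycle.transition_frame]
    change (((G a b).map (secRes (D.obj k) _)).map _) = _
    rw [map_secRes_map_appLE', hGdef, map_appLE_map_appLE', appLE_congr_hom' (c.w g)]
    rfl
  have hTN : ∀ a b, transition (eN a) (eN b) (Opens.infLELeft _ _) (Opens.infLERight _ _) =
      (T a b).map ((c.π.app j).appLE (D.map f ⁻¹ᵁ V a ⊓ D.map f ⁻¹ᵁ V b) _
        ((hle₂ a b).trans (hle a b))).hom := by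
    intro a b
    simp only [eN]
    rw [transition_restrictTrivialisation,
      Subsingleton.elim (Opens.infLELeft _ _ ≫ eqToHom (hWU a))
        (homOfLE (hle₂ a b) ≫ Opens.infLELeft (U a) (U b)),
      Subsingleton.elim (Opens.infLERight _ _ ≫ eqToHom (hWU b))
        (homOfLE (hle₂ a b) ≫ Opens.infLERight (U a) (U b)),
      ← transition_map, ← hT a b]
    exact map_appLE_map_secRes' (c.π.app j) (hle₂ a b) (hle a b) (T a b)
  have hWtop : (⨆ a, (c.π.app k ⁻¹ᵁ (D.map g ⁻¹ᵁ (D.map f ⁻¹ᵁ V a)) : c.pt.Opens)) = ⊤ := by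
    simp_rw [hWU]
    exact hUtop
  exact ⟨k, C.glued, hℰ, ⟨isoOfFrames _ eM eN (fun a b => (hTM a b).trans (hTN a b).symm) hWtop⟩⟩

end Literature.AlgebraicGeometry.Limits
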